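import Summits.CriticalPhenomena.PercolationContinuityZ3.Theorems.PercNearOneGluingNoHeavyLowerTailSahiDeepCoreHarris
import Mathlib.Order.UpperLower.Closure
import Mathlib.Tactic.Linarith
import Mathlib.Tactic.Ring
import HarnessLib

/-!
# `NoHeavyLowerTail` (crux stmt-CriticalPhenomena-4575), master-family line P1: the co-sunflower class law in DEEP-CORE FORM —
# normal form, the three-member identity with a defect, the equivalence, and the near-miss bound `E_3 ≥ −π₁π₂π₃`

Support file (seat `prim-masterthm-p1`, gen 10; `--supports stmt-CriticalPhenomena-4575`).  No definition, no `sorry`, standard axioms.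
Memo `run/shared/lean/prim/prim-masterthm/FROM-prim-masterthm-p1-g10-DEEP-CORE.md`; companion `…SahiDeepCoreHarris` (deep-core form of
Gladkov's strong Harris inequality, `Cov(A,B) ≥ μ(D(A,B))·(1 − μ(A∩B))`).

THE CLASS.  Sahi's `C_3` on the co-sunflower class `(G₂∪G₃, G₁∪G₃, G₁∪G₂)` (`G_i` increasing) — equivalently on triples of increasing
events `(A, B, N)` with `A ∖ B ⊆ N`, `B ∖ A ⊆ N`, `N ⊆ A ∪ B` ("sandwiched third member"; pairwise unions coincide) — is OPEN (= Kahn's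
Conjecture 5 on sunflower complements = the tree's `(1+a)(ab − e₂) ≥ e₃`).  This file reduces it to a statement about PAIRS of events.

1. IDENTITY WITH A DEFECT (`sahiE_three_sandwich_eq`, any weight; `a, b, t = μA, μB, μ(A∩B)`, `w = a + b − t`, `d' = μ((A∩B) ∖ N)`):
     `E_3(μ; 1_A, 1_B, 1_N) = (2 − w)·(t − ab) − d'·[(2 − w)(1 − t) + (a − t)(b − t)]`
   (this is the known closed form of the class functional — petal form `(1+a)(ab − e₂(c)) − e₃(c)`, tree `SahiPairInter` /
   `SahiSunflowerRowClosedForm` — rewritten around the pair `(A, B)` with the DEFECT `d'` of the third member).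
   So `E_3` depends on `N` only through `d'`, DEcreasingly (`sahiE_three_sandwich_mono`; = P2's floor transfer on this class): the worst
   third member is the smallest one, `N = ↑(A △ B)`, where `d' = μ(D(A,B))` is the deep core (NORMAL FORM).
2. EQUIVALENCE (`classLaw_iff_deepCoreForm`): the class law for all triples ⟺ for all increasing `A, B`
     `μ(D(A,B))·[(2 − w)(1 − t) + μ(A∖B)μ(B∖A)] ≤ (2 − w)·Cov(A,B)`,
   i.e. `Cov(A,B) ≥ μ(D)·[(1 − t) + μ(A∖B)μ(B∖A)/(2 − w)]`; its linear part `Cov ≥ μ(D)(1 − t)` is Gladkov's theorem in deep-core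
   form (`SahiDeepCore.deepCore_harris`), the cubic correction is what remains OPEN (gen 6: "AT_3 = Gladkov + e₃").
3. CONSEQUENCES (proved): for every sandwiched triple with `A, B` increasing
     `E_3 ≥ (2 − w)·(μ(D(A,B)) − d')·(1 − t) − d'·μ(A∖B)·μ(B∖A) ≥ −d'·μ(A∖B)·μ(B∖A)`  (`sahiE_three_sandwich_ge`, `…_ge_neg`),
   in generator form (`sahiE_three_coSunflower_ge_neg_privateParts`)
     `E_3(μ_p; G₂∪G₃, G₁∪G₃, G₁∪G₂) ≥ −μ(G₁∖(G₂∪G₃))·μ(G₂∖(G₁∪G₃))·μ(G₃∖(G₁∪G₂))`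
   (minus the product of the three PRIVATE PARTS; = "Gladkov bounds the quadratic part" made explicit), and
   `Cov(G₂∪G₃, G₁∪G₃) ≥ μ(G₃∖(G₁∪G₂))·(1 − μ((G₂∪G₃)∩(G₁∪G₃)))` (`cov_union_union_ge_privatePart`).
HONEST FRAMING: a reduction/packaging and an explicit near-miss bound, no new inequality; the class law and Kahn's Conjecture 5 remain
OPEN (the missing inequality is exactly `(2 − w)·[Cov(A,B) − μ(D)(1 − t)] ≥ μ(D)μ(A∖B)μ(B∖A)`, tight to leading order at the
percolation triangle; the gen-10 LP/NLP no-gos show it has no one-coordinate Harris+Gladkov+IH certificate even in normal form). [this work]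
-/

noncomputable section

open scoped Classical

namespace Summit.CriticalPhenomena.PercolationContinuityZ3.Theorems

namespace SahiDeepCore

open Finset Function
open Literature.Combinatorics.Sahi2008
open Literature.Probability.LatticeModels (prodBernoulli)
open Literature.Probability.Percolation.DecisionTree (ind ind_of_mem ind_of_not_mem ind_nonneg)

variable {ι : Type} [Fintype ι]

local notation3 (prettyPrint := false) "m⟦" p ", " X "⟧" => ex (bernoulliWeight p) (ind X)

/-! ### 1. The three-member identity -/

/-- **The three-member identity (pure algebra).**  With the sandwich relations `n = a + b − 2t + x`, `an = a − t + x`, `bn = b − t + x`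
(`x = μ(A∩B∩N)`), Sahi's cubic `2x + ab·n − (a·bn + b·an + n·t)` equals `(2 − w)(t − ab) − (t − x)[(2 − w)(1 − t) + (a − t)(b − t)]`,
`w = a + b − t`. [this work] -/
theorem three_member_identity (a b t x : ℝ) :
    2 * x + a * b * (a + b - 2 * t + x) - (a * (b - t + x) + b * (a - t + x) + (a + b - 2 * t + x) * t) =
      (2 - (a + b - t)) * (t - a * b) - (t - x) * ((2 - (a + b - t)) * (1 - t) + (a - t) * (b - t)) := by
  ring

omit [Fintype ι] in
/-- Pointwise indicator bookkeeping for a sandwiched third member: `1_N + 2·1_{A∩B} = 1_A + 1_B + 1_{A∩B∩N}`. [this work] -/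
theorem ind_sandwich_third {A B N : Set (Set ι)} (hAB : A \ B ⊆ N) (hBA : B \ A ⊆ N) (hN : N ⊆ A ∪ B) :
    ind N + (2 : ℝ) • ind (A ∩ B) = ind A + ind B + ind (A ∩ B ∩ N) := by
  funext ω
  simp only [Pi.add_apply, Pi.smul_apply, smul_eq_mul]
  by_cases ha : ω ∈ A <;> by_cases hb : ω ∈ B
  · rw [ind_of_mem ha, ind_of_mem hb, ind_of_mem (show ω ∈ A ∩ B from ⟨ha, hb⟩)]
    by_cases hn : ω ∈ N
    · rw [ind_of_mem hn, ind_of_mem (show ω ∈ A ∩ B ∩ N from ⟨⟨ha, hb⟩, hn⟩)]; norm_num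
    · rw [ind_of_not_mem hn, ind_of_not_mem (show ω ∉ A ∩ B ∩ N from fun h => hn h.2)]; norm_num
  · rw [ind_of_mem ha, ind_of_not_mem hb, ind_of_not_mem (show ω ∉ A ∩ B from fun h => hb h.2),
      ind_of_mem (hAB ⟨ha, hb⟩), ind_of_not_mem (show ω ∉ A ∩ B ∩ N from fun h => hb h.1.2)]; norm_num
  · rw [ind_of_not_mem ha, ind_of_mem hb, ind_of_not_mem (show ω ∉ A ∩ B from fun h => ha h.1),
      ind_of_mem (hBA ⟨hb, ha⟩), ind_of_not_mem (show ω ∉ A ∩ B ∩ N from fun h => ha h.1.1)]; norm_num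
  · have hn : ω ∉ N := fun h => (hN h).elim ha hb
    rw [ind_of_not_mem ha, ind_of_not_mem hb, ind_of_not_mem (show ω ∉ A ∩ B from fun h => ha h.1), ind_of_not_mem hn,
      ind_of_not_mem (show ω ∉ A ∩ B ∩ N from fun h => hn h.2)]; norm_num

omit [Fintype ι] in
/-- `1_{A∩N} + 1_{A∩B} = 1_A + 1_{A∩B∩N}` for a sandwiched third member. [this work] -/
theorem ind_sandwich_first {A B N : Set (Set ι)} (hAB : A \ B ⊆ N) (hN : N ⊆ A ∪ B) :
    ind (A ∩ N) + ind (A ∩ B) = ind A + ind (A ∩ B ∩ N) := by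
  funext ω
  simp only [Pi.add_apply]
  by_cases ha : ω ∈ A
  · rw [ind_of_mem ha]
    by_cases hb : ω ∈ B
    · rw [ind_of_mem (show ω ∈ A ∩ B from ⟨ha, hb⟩)]
      by_cases hn : ω ∈ N
      · rw [ind_of_mem (show ω ∈ A ∩ N from ⟨ha, hn⟩), ind_of_mem (show ω ∈ A ∩ B ∩ N from ⟨⟨ha, hb⟩, hn⟩)]
      · rw [ind_of_not_mem (show ω ∉ A ∩ N from fun h => hn h.2), ind_of_not_mem (show ω ∉ A ∩ B ∩ N from fun h => hn h.2)]
        norm_num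
    · rw [ind_of_not_mem (show ω ∉ A ∩ B from fun h => hb h.2), ind_of_mem (show ω ∈ A ∩ N from ⟨ha, hAB ⟨ha, hb⟩⟩),
        ind_of_not_mem (show ω ∉ A ∩ B ∩ N from fun h => hb h.1.2)]
  · have _ := hN
    rw [ind_of_not_mem ha, ind_of_not_mem (show ω ∉ A ∩ N from fun h => ha h.1), ind_of_not_mem (show ω ∉ A ∩ B from fun h => ha h.1),
      ind_of_not_mem (show ω ∉ A ∩ B ∩ N from fun h => ha h.1.1)]

omit [Fintype ι] in
/-- `1_{(A∩B)∖N} + 1_{A∩B∩N} = 1_{A∩B}`. [folklore] -/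
theorem ind_inter_split (A B N : Set (Set ι)) : ind ((A ∩ B) \ N) + ind (A ∩ B ∩ N) = ind (A ∩ B) := by
  funext ω
  simp only [Pi.add_apply]
  by_cases h : ω ∈ A ∩ B
  · rw [ind_of_mem h]
    by_cases hn : ω ∈ N
    · rw [ind_of_not_mem (show ω ∉ (A ∩ B) \ N from fun h' => h'.2 hn), ind_of_mem (show ω ∈ A ∩ B ∩ N from ⟨h, hn⟩)]; norm_num
    · rw [ind_of_mem (show ω ∈ (A ∩ B) \ N from ⟨h, hn⟩), ind_of_not_mem (show ω ∉ A ∩ B ∩ N from fun h' => hn h'.2)]; norm_num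
  · rw [ind_of_not_mem h, ind_of_not_mem (show ω ∉ (A ∩ B) \ N from fun h' => h h'.1),
      ind_of_not_mem (show ω ∉ A ∩ B ∩ N from fun h' => h h'.1)]; norm_num

/-- **THE THREE-MEMBER IDENTITY.**  For every weight `μ` (no normalisation or sign needed) and every triple of events `A, B, N` with `A ∖ B ⊆ N`,
`B ∖ A ⊆ N`, `N ⊆ A ∪ B` (sandwiched third member = "pairwise unions coincide"):
`E_3(μ; 1_A, 1_B, 1_N) = (2 − w)(t − ab) − μ((A∩B)∖N)·[(2 − w)(1 − t) + (a − t)(b − t)]`,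
`a = μA`, `b = μB`, `t = μ(A∩B)`, `w = a + b − t`.  No monotonicity is needed.  (The closed form itself is the tree's petal-form
`(1+a)(ab − e₂) − e₃` / `SahiPairInter.sahiE3_compl_pairInter_eq` in other variables; new here is only the defect parametrisation.) [this work] -/
theorem sahiE_three_sandwich_eq (μ : Set ι → ℝ) {A B N : Set (Set ι)} (hAB : A \ B ⊆ N) (hBA : B \ A ⊆ N)
    (hN : N ⊆ A ∪ B) :
    sahiE μ 3 ![ind A, ind B, ind N] =
      (2 - (ex μ (ind A) + ex μ (ind B) - ex μ (ind (A ∩ B)))) * (ex μ (ind (A ∩ B)) - ex μ (ind A) * ex μ (ind B))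
        - ex μ (ind ((A ∩ B) \ N)) * ((2 - (ex μ (ind A) + ex μ (ind B) - ex μ (ind (A ∩ B)))) * (1 - ex μ (ind (A ∩ B)))
          + (ex μ (ind A) - ex μ (ind (A ∩ B))) * (ex μ (ind B) - ex μ (ind (A ∩ B)))) := by
  have h1 : ex μ (ind N) + 2 * ex μ (ind (A ∩ B)) = ex μ (ind A) + ex μ (ind B) + ex μ (ind (A ∩ B ∩ N)) := by
    have h := congrArg (ex μ) (ind_sandwich_third hAB hBA hN)
    rwa [ex_add, ex_add, ex_add, ex_smul] at h
  have h2 : ex μ (ind (A ∩ N)) + ex μ (ind (A ∩ B)) = ex μ (ind A) + ex μ (ind (A ∩ B ∩ N)) := by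
    have h := congrArg (ex μ) (ind_sandwich_first hAB hN)
    rwa [ex_add, ex_add] at h
  have h3 : ex μ (ind (B ∩ N)) + ex μ (ind (A ∩ B)) = ex μ (ind B) + ex μ (ind (A ∩ B ∩ N)) := by
    have hBA' : B \ A ⊆ N := hBA
    have hN' : N ⊆ B ∪ A := fun ω h => (hN h).symm
    have h := congrArg (ex μ) (ind_sandwich_first hBA' hN')
    rw [ex_add, ex_add] at h
    rw [Set.inter_comm B A] at h
    exact h
  have h4 : ex μ (ind ((A ∩ B) \ N)) + ex μ (ind (A ∩ B ∩ N)) = ex μ (ind (A ∩ B)) := by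
    have h := congrArg (ex μ) (ind_inter_split A B N)
    rwa [ex_add] at h
  rw [sahiE_three]
  simp only [ind_mul_ind_eq_inter]
  rw [show A ∩ B ∩ N = A ∩ B ∩ N from rfl]
  have e5 : ex μ (ind N) = ex μ (ind A) + ex μ (ind B) - 2 * ex μ (ind (A ∩ B)) + ex μ (ind (A ∩ B ∩ N)) := by linarith
  have e6 : ex μ (ind (A ∩ N)) = ex μ (ind A) - ex μ (ind (A ∩ B)) + ex μ (ind (A ∩ B ∩ N)) := by linarith
  have e7 : ex μ (ind (B ∩ N)) = ex μ (ind B) - ex μ (ind (A ∩ B)) + ex μ (ind (A ∩ B ∩ N)) := by linarith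
  have e8 : ex μ (ind ((A ∩ B) \ N)) = ex μ (ind (A ∩ B)) - ex μ (ind (A ∩ B ∩ N)) := by linarith
  rw [e5, e6, e7, e8]
  ring

/-! ### 2. Monotonicity in the third member (normal form) and the near-miss bound -/

/-- Masses of differences are nonnegative differences: `μ(A∖B)·…` bookkeeping. [folklore] -/
private theorem m_sdiff_eq (p : ι → unitInterval) (A B : Set (Set ι)) : m⟦p, A \ B⟧ = m⟦p, A⟧ - m⟦p, A ∩ B⟧ := by
  have h := Pointwise.ex_ind_sub_of_subset (bernoulliWeight p) (Set.inter_subset_left : A ∩ B ⊆ A)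
  rw [Set.sdiff_self_inter] at h
  linarith

/-- **`E_3` is nonincreasing in `μ((A∩B)∖N)`; the coefficient `(2 − w)(1 − t) + μ(A∖B)μ(B∖A)` is nonnegative.** [this work] -/
theorem sandwich_coeff_nonneg (p : ι → unitInterval) (A B : Set (Set ι)) :
    0 ≤ (2 - (m⟦p, A⟧ + m⟦p, B⟧ - m⟦p, A ∩ B⟧)) * (1 - m⟦p, A ∩ B⟧)
        + (m⟦p, A⟧ - m⟦p, A ∩ B⟧) * (m⟦p, B⟧ - m⟦p, A ∩ B⟧) := by
  have hw : m⟦p, A⟧ + m⟦p, B⟧ - m⟦p, A ∩ B⟧ ≤ 1 := by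
    rw [← SahiCoSunflowerOrCoordinate.ex_ind_union]; exact ex_bernoulliWeight_ind_le_one p _
  have ht : m⟦p, A ∩ B⟧ ≤ 1 := ex_bernoulliWeight_ind_le_one p _
  have ha : 0 ≤ m⟦p, A⟧ - m⟦p, A ∩ B⟧ := by
    rw [← m_sdiff_eq]; exact ex_nonneg (isFKGMeasure_bernoulliWeight p).nonneg fun ω => ind_nonneg _ ω
  have hb : 0 ≤ m⟦p, B⟧ - m⟦p, A ∩ B⟧ := by
    rw [Set.inter_comm, ← m_sdiff_eq]; exact ex_nonneg (isFKGMeasure_bernoulliWeight p).nonneg fun ω => ind_nonneg _ ω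
  exact add_nonneg (mul_nonneg (by linarith) (sub_nonneg.2 ht)) (mul_nonneg ha hb)

/-- **NORMAL FORM (monotonicity in the third member).**  For sandwiched third members `N ⊆ N'` (same `A, B`),
`E_3(A,B,N) ≤ E_3(A,B,N')`: shrinking the third member can only decrease the class functional, so its minimum over admissible
increasing `N` is attained at the smallest one, `↑(A △ B)`. [this work] -/
theorem sahiE_three_sandwich_mono (p : ι → unitInterval) {A B N N' : Set (Set ι)} (hAB : A \ B ⊆ N) (hBA : B \ A ⊆ N)
    (hN' : N' ⊆ A ∪ B) (hNN' : N ⊆ N') :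
    sahiE (bernoulliWeight p) 3 ![ind A, ind B, ind N] ≤ sahiE (bernoulliWeight p) 3 ![ind A, ind B, ind N'] := by
  rw [sahiE_three_sandwich_eq (bernoulliWeight p) hAB hBA (hNN'.trans hN'),
    sahiE_three_sandwich_eq (bernoulliWeight p) (hAB.trans hNN') (hBA.trans hNN') hN']
  have hc := sandwich_coeff_nonneg p A B
  have hd : m⟦p, (A ∩ B) \ N'⟧ ≤ m⟦p, (A ∩ B) \ N⟧ :=
    ex_mono (isFKGMeasure_bernoulliWeight p).nonneg fun ω => by
      by_cases h : ω ∈ (A ∩ B) \ N'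
      · rw [ind_of_mem h, ind_of_mem (show ω ∈ (A ∩ B) \ N from ⟨h.1, fun hn => h.2 (hNN' hn)⟩)]
      · rw [ind_of_not_mem h]; exact ind_nonneg _ _
  nlinarith

/-- **THE NEAR-MISS BOUND.**  For increasing `A, B` and ANY sandwiched third member `N`,
`E_3(μ_p; 1_A, 1_B, 1_N) ≥ (2 − w)·(μ(D(A,B)) − μ((A∩B)∖N))·(1 − t) − μ((A∩B)∖N)·μ(A∖B)·μ(B∖A)`
(deep-core Harris supplies `(2 − w)[Cov − μ(D)(1 − t)] ≥ 0`). [this work] -/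
theorem sahiE_three_sandwich_ge (p : ι → unitInterval) {A B N : Set (Set ι)} (hA : IsUpperSet A) (hB : IsUpperSet B)
    (hAB : A \ B ⊆ N) (hBA : B \ A ⊆ N) (hNs : N ⊆ A ∪ B) :
    (2 - (m⟦p, A⟧ + m⟦p, B⟧ - m⟦p, A ∩ B⟧)) * (m⟦p, deepCore A B⟧ - m⟦p, (A ∩ B) \ N⟧) * (1 - m⟦p, A ∩ B⟧)
        - m⟦p, (A ∩ B) \ N⟧ * (m⟦p, A \ B⟧ * m⟦p, B \ A⟧) ≤
      sahiE (bernoulliWeight p) 3 ![ind A, ind B, ind N] := by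
  rw [sahiE_three_sandwich_eq (bernoulliWeight p) hAB hBA hNs, m_sdiff_eq p A B, m_sdiff_eq p B A, Set.inter_comm B A]
  have hDH := deepCore_harris p hA hB
  have hw : m⟦p, A⟧ + m⟦p, B⟧ - m⟦p, A ∩ B⟧ ≤ 1 := by
    rw [← SahiCoSunflowerOrCoordinate.ex_ind_union]; exact ex_bernoulliWeight_ind_le_one p _
  have ht : m⟦p, A ∩ B⟧ ≤ 1 := ex_bernoulliWeight_ind_le_one p _
  nlinarith [mul_le_mul_of_nonneg_left hDH (show (0 : ℝ) ≤ 2 - (m⟦p, A⟧ + m⟦p, B⟧ - m⟦p, A ∩ B⟧) by linarith)]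

/-- **`E_3 ≥ −μ((A∩B)∖N)·μ(A∖B)·μ(B∖A)` on the whole class** (increasing sandwiched triples). [this work] -/
theorem sahiE_three_sandwich_ge_neg (p : ι → unitInterval) {A B N : Set (Set ι)} (hA : IsUpperSet A) (hB : IsUpperSet B)
    (hN : IsUpperSet N) (hAB : A \ B ⊆ N) (hBA : B \ A ⊆ N) (hNs : N ⊆ A ∪ B) :
    -(m⟦p, (A ∩ B) \ N⟧ * m⟦p, A \ B⟧ * m⟦p, B \ A⟧) ≤ sahiE (bernoulliWeight p) 3 ![ind A, ind B, ind N] := by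
  have h := sahiE_three_sandwich_ge p hA hB hAB hBA hNs
  have hw : m⟦p, A⟧ + m⟦p, B⟧ - m⟦p, A ∩ B⟧ ≤ 1 := by
    rw [← SahiCoSunflowerOrCoordinate.ex_ind_union]; exact ex_bernoulliWeight_ind_le_one p _
  have ht : m⟦p, A ∩ B⟧ ≤ 1 := ex_bernoulliWeight_ind_le_one p _
  have hd : m⟦p, (A ∩ B) \ N⟧ ≤ m⟦p, deepCore A B⟧ :=
    ex_mono (isFKGMeasure_bernoulliWeight p).nonneg fun ω => by
      by_cases h : ω ∈ (A ∩ B) \ N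
      · rw [ind_of_mem h, ind_of_mem (inter_diff_subset_deepCore hN hAB hBA h)]
      · rw [ind_of_not_mem h]; exact ind_nonneg _ _
  have h3 : 0 ≤ (2 - (m⟦p, A⟧ + m⟦p, B⟧ - m⟦p, A ∩ B⟧)) * (m⟦p, deepCore A B⟧ - m⟦p, (A ∩ B) \ N⟧) * (1 - m⟦p, A ∩ B⟧) :=
    mul_nonneg (mul_nonneg (by linarith) (sub_nonneg.2 hd)) (sub_nonneg.2 ht)
  linarith

/-! ### 3. Generator form: the product of the three private parts -/

omit [Fintype ι] in
/-- The co-sunflower `(G₂∪G₃, G₁∪G₃, G₁∪G₂)` is a sandwiched triple. [this work] -/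
theorem coSunflower_sandwich (G₁ G₂ G₃ : Set (Set ι)) :
    (G₂ ∪ G₃) \ (G₁ ∪ G₃) ⊆ G₁ ∪ G₂ ∧ (G₁ ∪ G₃) \ (G₂ ∪ G₃) ⊆ G₁ ∪ G₂ ∧ G₁ ∪ G₂ ⊆ (G₂ ∪ G₃) ∪ (G₁ ∪ G₃) := by
  refine ⟨fun ω h => ?_, fun ω h => ?_, fun ω h => ?_⟩
  · rcases h.1 with h2 | h3
    · exact Or.inr h2
    · exact absurd (Or.inr h3) h.2
  · rcases h.1 with h1 | h3
    · exact Or.inl h1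
    · exact absurd (Or.inr h3) h.2
  · rcases h with h1 | h2
    · exact Or.inr (Or.inl h1)
    · exact Or.inl (Or.inl h2)

omit [Fintype ι] in
/-- The defect of the co-sunflower's third member is the private part of `G₃`: `((G₂∪G₃)∩(G₁∪G₃)) ∖ (G₁∪G₂) = G₃ ∖ (G₁∪G₂)`;
likewise `(G₂∪G₃) ∖ (G₁∪G₃) = G₂ ∖ (G₁∪G₃)` and `(G₁∪G₃) ∖ (G₂∪G₃) = G₁ ∖ (G₂∪G₃)`. [this work] -/
theorem coSunflower_privateParts (G₁ G₂ G₃ : Set (Set ι)) :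
    ((G₂ ∪ G₃) ∩ (G₁ ∪ G₃)) \ (G₁ ∪ G₂) = G₃ \ (G₁ ∪ G₂) ∧ (G₂ ∪ G₃) \ (G₁ ∪ G₃) = G₂ \ (G₁ ∪ G₃) ∧
      (G₁ ∪ G₃) \ (G₂ ∪ G₃) = G₁ \ (G₂ ∪ G₃) := by
  refine ⟨Set.ext fun ω => ?_, Set.ext fun ω => ?_, Set.ext fun ω => ?_⟩ <;>
    simp only [Set.mem_sdiff, Set.mem_inter_iff, Set.mem_union] <;> tauto

/-- **THEOREM (near-miss bound in generator form).**  For every finite cube, product weight and increasing `G₁, G₂, G₃`: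
`E_3(μ_p; G₂∪G₃, G₁∪G₃, G₁∪G₂) ≥ −μ(G₃∖(G₁∪G₂))·μ(G₂∖(G₁∪G₃))·μ(G₁∖(G₂∪G₃))` — the class functional is at least minus the
product of the three PRIVATE PARTS.  (The class law `E_3 ≥ 0` itself is open.) [this work] -/
theorem sahiE_three_coSunflower_ge_neg_privateParts (p : ι → unitInterval) {G₁ G₂ G₃ : Set (Set ι)} (h₁ : IsUpperSet G₁)
    (h₂ : IsUpperSet G₂) (h₃ : IsUpperSet G₃) :
    -(m⟦p, G₃ \ (G₁ ∪ G₂)⟧ * m⟦p, G₂ \ (G₁ ∪ G₃)⟧ * m⟦p, G₁ \ (G₂ ∪ G₃)⟧) ≤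
      sahiE (bernoulliWeight p) 3 ![ind (G₂ ∪ G₃), ind (G₁ ∪ G₃), ind (G₁ ∪ G₂)] := by
  obtain ⟨s1, s2, s3⟩ := coSunflower_sandwich G₁ G₂ G₃
  obtain ⟨e1, e2, e3⟩ := coSunflower_privateParts G₁ G₂ G₃
  have h := sahiE_three_sandwich_ge_neg p (h₂.union h₃) (h₁.union h₃) (h₁.union h₂) s1 s2 s3
  rwa [e1, e2, e3] at h

/-- **Covariance of two unions with a common part** (deep-core Harris in generator form): for increasing `G₁, G₂, G₃`,
`Cov(G₂∪G₃, G₁∪G₃) ≥ μ(G₃∖(G₁∪G₂))·(1 − μ((G₂∪G₃)∩(G₁∪G₃)))`. [this work] -/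
theorem cov_union_union_ge_privatePart (p : ι → unitInterval) {G₁ G₂ G₃ : Set (Set ι)} (h₁ : IsUpperSet G₁)
    (h₂ : IsUpperSet G₂) (h₃ : IsUpperSet G₃) :
    m⟦p, G₃ \ (G₁ ∪ G₂)⟧ * (1 - m⟦p, (G₂ ∪ G₃) ∩ (G₁ ∪ G₃)⟧) ≤
      m⟦p, (G₂ ∪ G₃) ∩ (G₁ ∪ G₃)⟧ - m⟦p, G₂ ∪ G₃⟧ * m⟦p, G₁ ∪ G₃⟧ := by
  obtain ⟨s1, s2, -⟩ := coSunflower_sandwich G₁ G₂ G₃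
  obtain ⟨e1, -, -⟩ := coSunflower_privateParts G₁ G₂ G₃
  have h := inter_diff_harris p (h₂.union h₃) (h₁.union h₃) (h₁.union h₂) s1 s2
  rwa [e1] at h

/-! ### 4. The equivalence: class law ⟺ deep-core form -/

omit [Fintype ι] in
/-- The smallest admissible third member `↑(A △ B)` (upper closure of the symmetric difference) is sandwiched, and its defect is
EXACTLY the deep core: `(A∩B) ∖ ↑(A△B) = D(A,B)`. [this work] -/
theorem upperClosure_symmDiff_sandwich {A B : Set (Set ι)} (hA : IsUpperSet A) (hB : IsUpperSet B) :
    A \ B ⊆ (↑(upperClosure ((A \ B) ∪ (B \ A))) : Set (Set ι)) ∧ B \ A ⊆ (↑(upperClosure ((A \ B) ∪ (B \ A))) : Set (Set ι)) ∧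
      (↑(upperClosure ((A \ B) ∪ (B \ A))) : Set (Set ι)) ⊆ A ∪ B ∧
        (A ∩ B) \ (↑(upperClosure ((A \ B) ∪ (B \ A))) : Set (Set ι)) = deepCore A B := by
  refine ⟨fun ω h => subset_upperClosure (Or.inl h), fun ω h => subset_upperClosure (Or.inr h), fun ω h => ?_, ?_⟩
  · rw [SetLike.mem_coe, mem_upperClosure] at h
    obtain ⟨ω', hω', hle⟩ := h
    rcases hω' with h' | h'
    · exact Or.inl (hA hle h'.1)
    · exact Or.inr (hB hle h'.1)
  · ext ω
    simp only [Set.mem_sdiff, Set.mem_inter_iff, SetLike.mem_coe, mem_upperClosure, Set.mem_union, not_exists, not_and,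
      deepCore, Set.mem_setOf_eq]
    constructor
    · rintro ⟨hω, h⟩
      refine ⟨hω, fun ω' hω' => ⟨fun ha => ?_, fun hb => ?_⟩⟩
      · by_contra hb; exact h ω' (Or.inl ⟨ha, hb⟩) hω'
      · by_contra ha; exact h ω' (Or.inr ⟨hb, ha⟩) hω'
    · rintro ⟨hω, h⟩
      refine ⟨hω, fun ω' hω' hle => ?_⟩
      rcases hω' with ⟨ha, hb⟩ | ⟨hb, ha⟩
      · exact hb ((h ω' hle).1 ha)
      · exact ha ((h ω' hle).2 hb)

/-- **THEOREM (the class law in deep-core form).**  On a finite cube with product weight `p`, the following are equivalent: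
(i) Sahi's `C_3` on the whole co-sunflower class: `0 ≤ E_3(μ_p; 1_A, 1_B, 1_N)` for all increasing `A, B, N` with `A∖B, B∖A ⊆ N ⊆ A∪B`;
(ii) the DEEP-CORE COVARIANCE INEQUALITY: for all increasing `A, B`,
  `μ(D(A,B))·[(2 − w)(1 − t) + μ(A∖B)μ(B∖A)] ≤ (2 − w)·(t − μ(A)μ(B))`  (`t = μ(A∩B)`, `w = μA + μB − t`).
Its linear part `μ(D)(1 − t) ≤ Cov` is the theorem `deepCore_harris`; the cubic correction is what remains OPEN. [this work] -/
theorem classLaw_iff_deepCoreForm (p : ι → unitInterval) :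
    (∀ A B N : Set (Set ι), IsUpperSet A → IsUpperSet B → IsUpperSet N → A \ B ⊆ N → B \ A ⊆ N → N ⊆ A ∪ B →
        0 ≤ sahiE (bernoulliWeight p) 3 ![ind A, ind B, ind N]) ↔
      (∀ A B : Set (Set ι), IsUpperSet A → IsUpperSet B →
        m⟦p, deepCore A B⟧ * ((2 - (m⟦p, A⟧ + m⟦p, B⟧ - m⟦p, A ∩ B⟧)) * (1 - m⟦p, A ∩ B⟧)
            + (m⟦p, A⟧ - m⟦p, A ∩ B⟧) * (m⟦p, B⟧ - m⟦p, A ∩ B⟧)) ≤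
          (2 - (m⟦p, A⟧ + m⟦p, B⟧ - m⟦p, A ∩ B⟧)) * (m⟦p, A ∩ B⟧ - m⟦p, A⟧ * m⟦p, B⟧)) := by
  constructor
  · intro h A B hA hB
    obtain ⟨s1, s2, s3, e⟩ := upperClosure_symmDiff_sandwich hA hB
    have h0 := h A B _ hA hB (upperClosure ((A \ B) ∪ (B \ A))).upper s1 s2 s3
    rw [sahiE_three_sandwich_eq (bernoulliWeight p) s1 s2 s3, e] at h0
    linarith
  · intro h A B N hA hB hN hAB hBA hNs
    rw [sahiE_three_sandwich_eq (bernoulliWeight p) hAB hBA hNs]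
    have h0 := h A B hA hB
    have hc := sandwich_coeff_nonneg p A B
    have hd : m⟦p, (A ∩ B) \ N⟧ ≤ m⟦p, deepCore A B⟧ :=
      ex_mono (isFKGMeasure_bernoulliWeight p).nonneg fun ω => by
        by_cases h' : ω ∈ (A ∩ B) \ N
        · rw [ind_of_mem h', ind_of_mem (inter_diff_subset_deepCore hN hAB hBA h')]
        · rw [ind_of_not_mem h']; exact ind_nonneg _ _
    nlinarith

/-- **Co-sunflower form of the equivalence** (`G`-parametrisation used by the lane): the class law for all increasing
`(G₂∪G₃, G₁∪G₃, G₁∪G₂)` follows from the deep-core covariance inequality (ii). [this work] -/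
theorem coSunflower_nonneg_of_deepCoreForm (p : ι → unitInterval)
    (h : ∀ A B : Set (Set ι), IsUpperSet A → IsUpperSet B →
      m⟦p, deepCore A B⟧ * ((2 - (m⟦p, A⟧ + m⟦p, B⟧ - m⟦p, A ∩ B⟧)) * (1 - m⟦p, A ∩ B⟧)
          + (m⟦p, A⟧ - m⟦p, A ∩ B⟧) * (m⟦p, B⟧ - m⟦p, A ∩ B⟧)) ≤
        (2 - (m⟦p, A⟧ + m⟦p, B⟧ - m⟦p, A ∩ B⟧)) * (m⟦p, A ∩ B⟧ - m⟦p, A⟧ * m⟦p, B⟧))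
    {G₁ G₂ G₃ : Set (Set ι)} (h₁ : IsUpperSet G₁) (h₂ : IsUpperSet G₂) (h₃ : IsUpperSet G₃) :
    0 ≤ sahiE (bernoulliWeight p) 3 ![ind (G₂ ∪ G₃), ind (G₁ ∪ G₃), ind (G₁ ∪ G₂)] := by
  obtain ⟨s1, s2, s3⟩ := coSunflower_sandwich G₁ G₂ G₃
  exact (classLaw_iff_deepCoreForm p).2 h _ _ _ (h₂.union h₃) (h₁.union h₃) (h₁.union h₂) s1 s2 s3

end SahiDeepCore

end Summit.CriticalPhenomena.PercolationContinuityZ3.Theorems
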